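import Mathlib
import HarnessLib
import Literature.Analysis.FluidPDE.LocalTypeI
import Literature.Analysis.FluidPDE.LocalTypeIReverseTools
import Literature.Analysis.FluidPDE.ClassicalSolution
import Literature.Analysis.FluidPDE.ClassicalSuitable
import Literature.Analysis.FluidPDE.WeakSolution
import Summits.NavierStokesRegularity.NavierStokesRegularity.Theorems.AxisTwistDoorTiltDominationLocScaledQuantities
import Summits.NavierStokesRegularity.NavierStokesRegularity.Theorems.PoloidalWindowDoorPoloidalWindowRigiditySparseEnergyScaledEnergy
import Summits.NavierStokesRegularity.NavierStokesRegularity.Theorems.PoloidalWindowDoorPoloidalWindowRigiditySparseEnergyScaledCubic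
import Summits.NavierStokesRegularity.NavierStokesRegularity.Theorems.PoloidalWindowDoorPoloidalWindowRigiditySparseEnergyScaledPressureD
import Summits.NavierStokesRegularity.NavierStokesRegularity.Theorems.ChiralWindowDoorClassDerivDecay
import Summits.NavierStokesRegularity.NavierStokesRegularity.Theorems.AxisTwistDoorTiltDominationLocDefs
import Summits.NavierStokesRegularity.NavierStokesRegularity.Theorems.FilamentPinchDoorFilamentaryGrowth
import Summits.NavierStokesRegularity.NavierStokesRegularity.Theorems.AxisTwistDoorTiltDominationLocRigidity

/-!
# AxisTwistDoor · crux `TiltDominationLoc` (stmt-NavierStokesRegularity-26991) — THE ENERGY CLASS IS AUTOMATIC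
# (`𝐈 < ∞`, slab suitability and the weak gradient follow from the four Type-I-mild hypotheses), and the CORE
# FORMS of the research statements

The items of route `AxisTwistDoor` (and of `FilamentPinchDoor`) quantify over the ENERGY CLASS: a Type-I ancient
Oseen-mild profile (rate `‖v(t)‖ ≤ C/√(−t)`, continuity on the open backward slab, unit-viscosity Oseen identity
between negative times, divergence-free slices) that is ALSO a suitable weak solution on the slab with some pressure
`π`, a weak spatial gradient `H`, and Albritton–Barker's `𝐈(ℝ³ × ℝ₋) = typeIBound (Iio 0 ×ˢ univ) v π H < ∞`.

* `typeIBound_slab_lt_top_of_class`, `exists_energyClass_of_typeI` — **the last three hypotheses are consequences of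
  the first four.**  Pressure: a class profile is classical on `(−∞,0)` (`ChiralWindowDoorClassDerivDecay.
  exists_classical_of_class`); suitability and `H = ∇v`: CKN 1982 §2 for classical solutions
  (`isSuitableWeakSolutionOn_of_contDiffOn`, `hasWeakSpatialGradientOn_of_contDiffOn`); `𝐈 < ∞`: the K2 lineage's
  a-priori package for the Type-I mild class — slice energy and enstrophy `scaledEnergy` (p633959), cubic quantity
  `scaledCubic` (p637468), pressure oscillation `scaledPressure_threeHalves` (p638571) — converted to Albritton–Barker's
  `A, C, D, E` on every past ball by `…TiltDominationLocScaledQuantities` (the window pressure of the K2 package and the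
  global classical pressure differ by a function of time, invisible to the mean-free `D`).
* `poloidalRigidity_iff_typeI`, `oneSignedRigidity_iff_typeI`, `singularIsPoloidal_iff_typeI` — the dictionary Props of
  `…TiltDominationLocDefs` with the energy-class binders DELETED;
* `oneSignedRigidity_iff_core`, `singularIsPoloidal_iff_core` — with the linear-growth hypothesis deleted too (it follows
  from the sign, `axisTwistDoor_filamentaryGrowth_proof`, item 26431): **the crux `TiltDominationLoc` is equivalent to
  «no Type-I ancient Oseen-mild profile with `ω₃ ≥ 0` is backward-singular at the apex»**, and stub 2 to «a singular
  one reads `ω₃ ≡ 0`», i.e. to HalfSpaceWindowDoor's crux `CirculationCarryingRigidity` (25311) read at `e₃`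
  (`singularIsPoloidal_iff_circulationCarrying_e3`; by name `…Rigidity.singularIsPoloidal_of_circulationCarryingRigidity`).

So the three routes on the leaf `HalfSpaceWindowDoor.Target` owe the same two research statements: the poloidal Type-I
Liouville theorem (19708, whose class is exactly the four-hypothesis class by `poloidalRigidity_iff_typeI`) and
«one-signed & singular ⇒ poloidal» (25311 ≅ 26430 ≅ stub 2 of 26991).  WHAT THIS IS NOT: none of these research
statements is proved; no Navier–Stokes regularity statement is proved (Clay A OPEN).  Seat ns-atd-p1 (LEAD g3).
[cite: AlbrittonBarker2019, §1 and Lemma 2.6; CaffarelliKohnNirenberg1982, §2; KochNadirashviliSereginSverak2009, §4]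
-/

noncomputable section

-- the summit and its single sub-problem share the name (CONVENTIONS §1), as in every Theorems file
set_option linter.dupNamespace false

namespace Summit.NavierStokesRegularity.NavierStokesRegularity.Theorems.AxisTwistDoorTiltDominationLocEnergyClass

open Set Function Filter Topology MeasureTheory Metric
open scoped ENNReal NNReal InnerProductSpace
open Literature.Analysis Literature.Analysis.FluidPDE
open Summit.NavierStokesRegularity.NavierStokesRegularity.Theorems.AxisTwistDoorTiltDominationLocScaledQuantities
open Summit.NavierStokesRegularity.NavierStokesRegularity.Theorems.AxisTwistDoorTiltDominationLocDefs

variable {C : ℝ} {v : ℝ → EuclideanSpace ℝ (Fin 3) → EuclideanSpace ℝ (Fin 3)}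

/-- **`𝐈(ℝ³ × ℝ₋) < ∞` for every profile of the Type-I mild class, with ANY classical pressure on `(−∞,0)`**
(`∇v := fderiv`).  On a past ball `Q(z,r)` (`z.1 ≤ 0`): `A ≤ K` and `E ≤ 3K` by the K2 lineage's `scaledEnergy`
(slice energy and enstrophy, up to the apex by monotone convergence), `C ≤ K₃` by `scaledCubic`, and `D ≤ 4D₀` by
`scaledPressure_threeHalves` — the window pressure there differs from `q` by a function of time
(`pressure_sub_eq_of_classical`), which the mean-free `D` does not see. -/
theorem typeIBound_slab_lt_top_of_class (hrate : HasTypeITimeDecay C v)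
    (hcont : ContinuousOn (uncurry v) (Iio (0 : ℝ) ×ˢ univ))
    (hmild : ∀ s t : ℝ, s < t → t < 0 → ∀ x,
      v t x = UnboundedOperators.heatExtension (v s) (t - s) x - oseenDuhamel 1 s v v t x)
    (hdiv : ∀ t < 0, VectorCalculus.IsDivFree (v t))
    {q : ℝ → EuclideanSpace ℝ (Fin 3) → ℝ} (hcl : IsClassicalNSSolutionOn (Iio (0 : ℝ)) 1 0 v q) :
    typeIBound (Iio (0 : ℝ) ×ˢ (univ : Set (EuclideanSpace ℝ (Fin 3)))) v q (fun t x => fderiv ℝ (v t) x) < ⊤ := by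
  obtain ⟨K, hK0, hK⟩ :=
    PoloidalWindowDoorPoloidalWindowRigiditySparseEnergyScaledEnergy.scaledEnergy hrate hcont hmild hdiv
  obtain ⟨K₃, hK₃0, hK₃⟩ :=
    PoloidalWindowDoorPoloidalWindowRigiditySparseEnergyScaledCubic.scaledCubic hrate hcont hmild hdiv
  obtain ⟨D₀, hD₀0, hD⟩ :=
    PoloidalWindowDoorPoloidalWindowRigiditySparseEnergyScaledPressureD.scaledPressure_threeHalves hrate hcont hmild hdiv
  set M : ℝ≥0∞ := ENNReal.ofReal K + ENNReal.ofReal K₃ + ENNReal.ofReal (4 * D₀) + ENNReal.ofReal (3 * K) with hM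
  refine lt_of_le_of_lt (typeIBound_le_iff.2 fun r hr z hz => ?_) (show M < ⊤ from ?_)
  swap
  · exact ENNReal.add_lt_top.2 ⟨ENNReal.add_lt_top.2 ⟨ENNReal.add_lt_top.2
      ⟨ENNReal.ofReal_lt_top, ENNReal.ofReal_lt_top⟩, ENNReal.ofReal_lt_top⟩, ENNReal.ofReal_lt_top⟩
  have hz0 : z.1 ≤ 0 := top_nonpos_of_subset_slab hr hz
  -- A, C, E
  have hA : cknAEss r z v ≤ ENNReal.ofReal K :=
    cknAEss_le_of_slice (fun t ht a R hR => (hK t ht a R hR).1) hr hz0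
  have hC : cknC r z v ≤ ENNReal.ofReal K₃ := cknC_le_of_iterated hK₃ hr hz0
  have hE : cknE r z (fun t x => fderiv ℝ (v t) x) ≤ ENNReal.ofReal (3 * K) :=
    cknE_le_of_iterated (fun t₀ ht₀ a R hR => (hK t₀ ht₀ a R hR).2) hr hz0
  -- D: the window pressure on `(z.1 − r² − 1, 0)`
  have hT : z.1 - r ^ 2 - 1 < 0 := by nlinarith [sq_nonneg r]
  obtain ⟨qT, hclT, hDT⟩ := hD (z.1 - r ^ 2 - 1) hT
  obtain ⟨c, hc⟩ := hDT z.1 hz0 z.2 r hr (by linarith)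
  -- `q = qT + e(t)` on the window
  set e : ℝ → ℝ := fun t => q t z.2 - qT t z.2 with he
  have hqe : ∀ t ∈ Ioo (z.1 - r ^ 2) z.1, (fun x => q t x - e t) = qT t := by
    intro t ht
    have ht0 : t ∈ Iio (0 : ℝ) := lt_of_lt_of_le ht.2 hz0
    have htT : t ∈ Ioo (z.1 - r ^ 2 - 1) 0 := ⟨by linarith [ht.1], ht0⟩
    funext x
    have h := pressure_sub_eq_of_classical isOpen_Iio isOpen_Ioo hcl hclT ht0 htT x z.2
    simp only [he]
    linarith
  have hint : ∀ t ∈ Ioo (z.1 - r ^ 2) z.1, IntegrableOn (q t) (ball z.2 r) volume := by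
    intro t ht
    have ht0 : t ∈ Iio (0 : ℝ) := lt_of_lt_of_le ht.2 hz0
    exact (((hcl.contDiff_pressure ht0).continuous.continuousOn).integrableOn_compact
      (isCompact_closedBall z.2 r)).mono_set ball_subset_closedBall
  have hintT : ∀ t ∈ Ioo (z.1 - r ^ 2) z.1, IntegrableOn (qT t) (ball z.2 r) volume := by
    intro t ht
    have htT : t ∈ Ioo (z.1 - r ^ 2 - 1) 0 := ⟨by linarith [ht.1], lt_of_lt_of_le ht.2 hz0⟩
    exact (((hclT.contDiff_pressure htT).continuous.continuousOn).integrableOn_compact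
      (isCompact_closedBall z.2 r)).mono_set ball_subset_closedBall
  have hDq : cknDOsc r z q ≤ ENNReal.ofReal (4 * D₀) := by
    have h1 : cknDOsc r z q = cknDOsc r z (fun t x => q t x - e t) :=
      (cknDOsc_sub_fun_time hr e (by
        filter_upwards [ae_restrict_mem measurableSet_Ioo] with t ht
        exact hint t ht)).symm
    rw [h1, cknDOsc_congr_slices hqe]
    exact cknDOsc_le_of_iterated hintT hc hr
  -- sum
  calc abScaledSum r z v q (fun t x => fderiv ℝ (v t) x)
      = cknAEss r z v + cknC r z v + cknDOsc r z q + cknE r z (fun t x => fderiv ℝ (v t) x) := rfl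
    _ ≤ M := by
        rw [hM]
        gcongr

/-- **THE ENERGY CLASS IS AUTOMATIC.**  Every profile of the Type-I mild class (Type-I time rate, continuity on the
open backward slab, unit-viscosity Oseen identity between negative times, divergence-free slices) is, with a classical
pressure `π` on `(−∞,0)` and `H := ∇v`, a suitable weak solution on the backward slab with a weak spatial gradient and
Albritton–Barker's `𝐈(ℝ³ × ℝ₋) < ∞` — i.e. it satisfies the three "energy-class" hypotheses of the route's items
(`InClass`; crux texts of 26888/26889/26991/26431/26432).  Classical pressure: `exists_classical_of_class`; suitability and
weak gradient: CKN 1982 §2 for classical solutions (`isSuitableWeakSolutionOn_of_contDiffOn`,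
`hasWeakSpatialGradientOn_of_contDiffOn`); `𝐈 < ∞`: `typeIBound_slab_lt_top_of_class`. -/
theorem exists_energyClass_of_typeI (hrate : HasTypeITimeDecay C v)
    (hcont : ContinuousOn (uncurry v) (Iio (0 : ℝ) ×ˢ univ))
    (hmild : ∀ s t : ℝ, s < t → t < 0 → ∀ x,
      v t x = UnboundedOperators.heatExtension (v s) (t - s) x - oseenDuhamel 1 s v v t x)
    (hdiv : ∀ t < 0, VectorCalculus.IsDivFree (v t)) :
    ∃ (π : ℝ → EuclideanSpace ℝ (Fin 3) → ℝ)
      (H : ℝ → EuclideanSpace ℝ (Fin 3) → EuclideanSpace ℝ (Fin 3) →L[ℝ] EuclideanSpace ℝ (Fin 3)),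
      IsSuitableWeakSolutionOn (slab (EuclideanSpace ℝ (Fin 3)) (Iio (0 : ℝ)) isOpen_Iio) 1 0 v π ∧
      HasWeakSpatialGradientOn (slab (EuclideanSpace ℝ (Fin 3)) (Iio (0 : ℝ)) isOpen_Iio) v H ∧
      typeIBound (Iio (0 : ℝ) ×ˢ univ) v π H < ⊤ := by
  obtain ⟨q, hcl⟩ := ChiralWindowDoorClassDerivDecay.exists_classical_of_class hrate hcont hmild hdiv
  have hQ : (((slab (EuclideanSpace ℝ (Fin 3)) (Iio (0 : ℝ)) isOpen_Iio) : TopologicalSpace.Opens (ℝ × (EuclideanSpace ℝ (Fin 3)))) :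
      Set (ℝ × (EuclideanSpace ℝ (Fin 3)))) ⊆ Iio (0 : ℝ) ×ˢ univ := by
    rw [coe_slab]
  refine ⟨q, fun t x => fderiv ℝ (v t) x, ?_, ?_, typeIBound_slab_lt_top_of_class hrate hcont hmild hdiv hcl⟩
  · refine isSuitableWeakSolutionOn_of_contDiffOn isOpen_Iio hQ
      (hcl.smooth_velocity.of_le (by norm_cast)) (hcl.smooth_pressure.of_le (by norm_cast))
      continuousOn_const (fun t ht x => ?_) hcl.divFree
    have hm := hcl.momentum t ht x
    rwa [timeDerivWithin_apply, derivWithin_of_isOpen isOpen_Iio ht, ← timeDeriv_apply] at hm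
  · exact hasWeakSpatialGradientOn_of_contDiffOn isOpen_Iio hQ (hcl.smooth_velocity.of_le (by norm_cast))

/-- **`InClass` from the four Type-I-mild hypotheses** (the route's vocabulary, `…AveragedConeLiouvilleDefs.InClass` is
not imported here; this is its content): some `π, H` complete the profile to the energy class. -/
theorem exists_inClass_hypotheses (hrate : HasTypeITimeDecay C v)
    (hcont : ContinuousOn (uncurry v) (Iio (0 : ℝ) ×ˢ univ))
    (hmild : ∀ s t : ℝ, s < t → t < 0 → ∀ x,
      v t x = UnboundedOperators.heatExtension (v s) (t - s) x - oseenDuhamel 1 s v v t x)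
    (hdiv : ∀ t < 0, VectorCalculus.IsDivFree (v t)) :
    ∃ (π : ℝ → EuclideanSpace ℝ (Fin 3) → ℝ)
      (H : ℝ → EuclideanSpace ℝ (Fin 3) → EuclideanSpace ℝ (Fin 3) →L[ℝ] EuclideanSpace ℝ (Fin 3)),
      Literature.Analysis.FluidPDE.IsSuitableWeakSolutionOn (Literature.Analysis.FluidPDE.slab (EuclideanSpace ℝ (Fin 3)) (Set.Iio (0 : ℝ)) isOpen_Iio) 1 0 v π ∧
      Literature.Analysis.FluidPDE.HasWeakSpatialGradientOn (Literature.Analysis.FluidPDE.slab (EuclideanSpace ℝ (Fin 3)) (Set.Iio (0 : ℝ)) isOpen_Iio) v H ∧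
      Literature.Analysis.FluidPDE.typeIBound (Set.Iio (0 : ℝ) ×ˢ Set.univ) v π H < ⊤ :=
  exists_energyClass_of_typeI hrate hcont hmild hdiv

/-! ### The dictionary's Props lose their energy-class hypotheses -/

/-- **`PoloidalRigidity` without the energy class**: it is equivalent to «no Type-I mild profile with `ω₃ ≡ 0` is
backward-singular at the apex» (the four-hypothesis class of the shared crux 19708). -/
theorem poloidalRigidity_iff_typeI : PoloidalRigidity ↔
    ∀ (C : ℝ) (v : ℝ → EuclideanSpace ℝ (Fin 3) → EuclideanSpace ℝ (Fin 3)),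
      HasTypeITimeDecay C v → ContinuousOn (uncurry v) (Iio (0 : ℝ) ×ˢ univ) →
      (∀ s t : ℝ, s < t → t < 0 → ∀ x,
        v t x = UnboundedOperators.heatExtension (v s) (t - s) x - oseenDuhamel 1 s v v t x) →
      (∀ t < 0, VectorCalculus.IsDivFree (v t)) →
      (∀ s < 0, ∀ y, ⟪curl (v s) y, (EuclideanSpace.single (2 : Fin 3) (1 : ℝ))⟫_ℝ = 0) →
      ¬ IsBackwardSingularPoint v 0 := by
  constructor
  · intro h C v hrate hcont hmild hdiv hpol
    obtain ⟨π, H, hsw, hwg, hI⟩ := exists_energyClass_of_typeI hrate hcont hmild hdiv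
    exact h C v π H hrate hcont hmild hdiv hsw hwg hI hpol
  · intro h C v π H hrate hcont hmild hdiv _ _ _ hpol
    exact h C v hrate hcont hmild hdiv hpol

/-- **`OneSignedRigidity` without the energy class and without the growth hypothesis as a separate input**: it is
equivalent to «no Type-I mild profile with `ω₃ ≥ 0` and linear `e₃`-ball growth is backward-singular at the apex». -/
theorem oneSignedRigidity_iff_typeI : OneSignedRigidity ↔
    ∀ (C : ℝ) (v : ℝ → EuclideanSpace ℝ (Fin 3) → EuclideanSpace ℝ (Fin 3)),
      HasTypeITimeDecay C v → ContinuousOn (uncurry v) (Iio (0 : ℝ) ×ˢ univ) →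
      (∀ s t : ℝ, s < t → t < 0 → ∀ x,
        v t x = UnboundedOperators.heatExtension (v s) (t - s) x - oseenDuhamel 1 s v v t x) →
      (∀ t < 0, VectorCalculus.IsDivFree (v t)) →
      (∀ s < 0, ∀ y, 0 ≤ ⟪curl (v s) y, (EuclideanSpace.single (2 : Fin 3) (1 : ℝ))⟫_ℝ) →
      (∃ K : ℝ, ∀ s < 0, ∀ (x : EuclideanSpace ℝ (Fin 3)) (R : ℝ), 0 < R →
        ∫⁻ y in ball x R, ENNReal.ofReal ⟪curl (v s) y, (EuclideanSpace.single (2 : Fin 3) (1 : ℝ))⟫_ℝ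
          ≤ ENNReal.ofReal (K * R)) →
      ¬ IsBackwardSingularPoint v 0 := by
  constructor
  · intro h C v hrate hcont hmild hdiv hnn hK
    obtain ⟨π, H, hsw, hwg, hI⟩ := exists_energyClass_of_typeI hrate hcont hmild hdiv
    exact h C v π H hrate hcont hmild hdiv hsw hwg hI hnn hK
  · intro h C v π H hrate hcont hmild hdiv _ _ _ hnn hK
    exact h C v hrate hcont hmild hdiv hnn hK

/-- **`SingularIsPoloidal` without the energy class**. -/
theorem singularIsPoloidal_iff_typeI : SingularIsPoloidal ↔
    ∀ (C : ℝ) (v : ℝ → EuclideanSpace ℝ (Fin 3) → EuclideanSpace ℝ (Fin 3)),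
      HasTypeITimeDecay C v → ContinuousOn (uncurry v) (Iio (0 : ℝ) ×ˢ univ) →
      (∀ s t : ℝ, s < t → t < 0 → ∀ x,
        v t x = UnboundedOperators.heatExtension (v s) (t - s) x - oseenDuhamel 1 s v v t x) →
      (∀ t < 0, VectorCalculus.IsDivFree (v t)) →
      (∀ s < 0, ∀ y, 0 ≤ ⟪curl (v s) y, (EuclideanSpace.single (2 : Fin 3) (1 : ℝ))⟫_ℝ) →
      (∃ K : ℝ, ∀ s < 0, ∀ (x : EuclideanSpace ℝ (Fin 3)) (R : ℝ), 0 < R →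
        ∫⁻ y in ball x R, ENNReal.ofReal ⟪curl (v s) y, (EuclideanSpace.single (2 : Fin 3) (1 : ℝ))⟫_ℝ
          ≤ ENNReal.ofReal (K * R)) →
      IsBackwardSingularPoint v 0 →
      ∀ s < 0, ∀ y, ⟪curl (v s) y, (EuclideanSpace.single (2 : Fin 3) (1 : ℝ))⟫_ℝ = 0 := by
  constructor
  · intro h C v hrate hcont hmild hdiv hnn hK hsing
    obtain ⟨π, H, hsw, hwg, hI⟩ := exists_energyClass_of_typeI hrate hcont hmild hdiv
    exact h C v π H hrate hcont hmild hdiv hsw hwg hI hnn hK hsing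
  · intro h C v π H hrate hcont hmild hdiv _ _ _ hnn hK hsing
    exact h C v hrate hcont hmild hdiv hnn hK hsing


/-! ### The research cores, with every idle hypothesis removed -/

/-- **CORE FORM OF THE CRUX.**  `OneSignedRigidity` (hence `TiltDominationLoc`, by
`…Rigidity.tiltDominationLoc_iff_oneSignedRigidity`) is equivalent to: «no Type-I ancient Oseen-mild profile (rate,
continuity, Oseen identity, divergence-free slices) with `⟪curl v(s), e₃⟫ ≥ 0` everywhere is backward-singular at the
apex» — the energy class is automatic (`exists_energyClass_of_typeI`) and the linear `e₃`-ball growth follows from the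
sign in the energy class (`axisTwistDoor_filamentaryGrowth_proof`, item 26431). -/
theorem oneSignedRigidity_iff_core : OneSignedRigidity ↔
    ∀ (C : ℝ) (v : ℝ → EuclideanSpace ℝ (Fin 3) → EuclideanSpace ℝ (Fin 3)),
      HasTypeITimeDecay C v → ContinuousOn (uncurry v) (Iio (0 : ℝ) ×ˢ univ) →
      (∀ s t : ℝ, s < t → t < 0 → ∀ x,
        v t x = UnboundedOperators.heatExtension (v s) (t - s) x - oseenDuhamel 1 s v v t x) →
      (∀ t < 0, VectorCalculus.IsDivFree (v t)) →
      (∀ s < 0, ∀ y, 0 ≤ ⟪curl (v s) y, (EuclideanSpace.single (2 : Fin 3) (1 : ℝ))⟫_ℝ) →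
      ¬ IsBackwardSingularPoint v 0 := by
  rw [oneSignedRigidity_iff_typeI]
  constructor
  · intro h C v hrate hcont hmild hdiv hnn
    obtain ⟨π, H, hsw, hwg, hI⟩ := exists_energyClass_of_typeI hrate hcont hmild hdiv
    exact h C v hrate hcont hmild hdiv hnn
      (axisTwistDoor_filamentaryGrowth_proof C v π H hrate hcont hmild hdiv hsw hwg hI _ AxisTwistDoorTiltDominationLocRigidity.e3_ne_zero hnn)
  · intro h C v hrate hcont hmild hdiv hnn _
    exact h C v hrate hcont hmild hdiv hnn

/-- **CORE FORM OF STUB 2.**  `SingularIsPoloidal` is equivalent to: «a Type-I ancient Oseen-mild profile with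
`⟪curl v(s), e₃⟫ ≥ 0` everywhere which is backward-singular at the apex has `⟪curl v(s), e₃⟫ ≡ 0`» — which is
HalfSpaceWindowDoor's research crux `CirculationCarryingRigidity` (item 25311) read at `e = e₃`. -/
theorem singularIsPoloidal_iff_core : SingularIsPoloidal ↔
    ∀ (C : ℝ) (v : ℝ → EuclideanSpace ℝ (Fin 3) → EuclideanSpace ℝ (Fin 3)),
      HasTypeITimeDecay C v → ContinuousOn (uncurry v) (Iio (0 : ℝ) ×ˢ univ) →
      (∀ s t : ℝ, s < t → t < 0 → ∀ x,
        v t x = UnboundedOperators.heatExtension (v s) (t - s) x - oseenDuhamel 1 s v v t x) →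
      (∀ t < 0, VectorCalculus.IsDivFree (v t)) →
      (∀ s < 0, ∀ y, 0 ≤ ⟪curl (v s) y, (EuclideanSpace.single (2 : Fin 3) (1 : ℝ))⟫_ℝ) →
      IsBackwardSingularPoint v 0 →
      ∀ s < 0, ∀ y, ⟪curl (v s) y, (EuclideanSpace.single (2 : Fin 3) (1 : ℝ))⟫_ℝ = 0 := by
  rw [singularIsPoloidal_iff_typeI]
  constructor
  · intro h C v hrate hcont hmild hdiv hnn hsing
    obtain ⟨π, H, hsw, hwg, hI⟩ := exists_energyClass_of_typeI hrate hcont hmild hdiv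
    exact h C v hrate hcont hmild hdiv hnn
      (axisTwistDoor_filamentaryGrowth_proof C v π H hrate hcont hmild hdiv hsw hwg hI _ AxisTwistDoorTiltDominationLocRigidity.e3_ne_zero hnn) hsing
  · intro h C v hrate hcont hmild hdiv hnn _ hsing
    exact h C v hrate hcont hmild hdiv hnn hsing

/-- **Stub 2 IS HalfSpaceWindowDoor's crux at `e₃`**: `SingularIsPoloidal` is implied by, and implies the `e = e₃`
instance of, `HalfSpaceWindowDoor.CirculationCarryingRigidity` (item 25311); here the `e₃`-instance as an `↔`. -/
theorem singularIsPoloidal_iff_circulationCarrying_e3 : SingularIsPoloidal ↔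
    ∀ (C : ℝ) (v : ℝ → EuclideanSpace ℝ (Fin 3) → EuclideanSpace ℝ (Fin 3)),
      HasTypeITimeDecay C v → ContinuousOn (uncurry v) (Iio (0 : ℝ) ×ˢ univ) →
      (∀ s t : ℝ, s < t → t < 0 → ∀ x,
        v t x = UnboundedOperators.heatExtension (v s) (t - s) x - oseenDuhamel 1 s v v t x) →
      (∀ t < 0, VectorCalculus.IsDivFree (v t)) →
      (∀ s < 0, ∀ y, 0 ≤ ⟪curl (v s) y, (EuclideanSpace.single (2 : Fin 3) (1 : ℝ))⟫_ℝ) →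
      (∃ s, s < 0 ∧ ∃ y, 0 < ⟪curl (v s) y, (EuclideanSpace.single (2 : Fin 3) (1 : ℝ))⟫_ℝ) →
      ¬ IsBackwardSingularPoint v 0 := by
  rw [singularIsPoloidal_iff_core]
  constructor
  · rintro h C v hrate hcont hmild hdiv hnn ⟨s, hs, y, hpos⟩ hsing
    exact absurd (h C v hrate hcont hmild hdiv hnn hsing s hs y) hpos.ne'
  · intro h C v hrate hcont hmild hdiv hnn hsing s hs y
    by_contra hne
    exact h C v hrate hcont hmild hdiv hnn ⟨s, hs, y, lt_of_le_of_ne (hnn s hs y) (Ne.symm hne)⟩ hsing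

end Summit.NavierStokesRegularity.NavierStokesRegularity.Theorems.AxisTwistDoorTiltDominationLocEnergyClass

end
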